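import Literature.NumberTheory.LFunctions.RHWave0
import Literature.NumberTheory.EllipticCurves.HasseManin
import HarnessLib

/-!
# RH family — wave 0: discharge of the Hasse bound (`rh.S36`)

Second sibling proofs file (D-0014) for `Literature/NumberTheory/LFunctions/RHWave0.lean`, next to
`RHWave0Proofs.lean` (which discharges `not_polya_conjecture` by a `native_decide` computation and
is therefore flagged computational; the present discharge uses only the standard axioms, hence a
separate file). It discharges the named fact `Literature.NumberTheory.LFunctions.hasse_bound` — Hasse's theorem, the Riemann
hypothesis for elliptic curves over finite fields: `|#W(𝔽_q) - q - 1| ≤ 2√q` for every elliptic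
curve `W` over a finite field with `q` elements (Hasse 1936; Silverman, *AEC* Thm. V.1.1) — from
the theorem
`Literature.NumberTheory.EllipticCurves.HasseManin.abs_card_sub_le` of `Literature.NumberTheory.EllipticCurves.HasseManin`, which is
proved there (modules `HasseManinFunctionField`, `HasseManinPolynomials`, `HasseManin` — parts
I, II and III–V of the argument) in every characteristic by the function-field form of Manin's
elementary argument (Manin 1956; Chahal 2021, §10.3; Chahal–Soomro–Top 2014, §1).

* `Literature.RH.hasse_bound_holds : hasse_bound`.

## References

* J. H. Silverman, *The Arithmetic of Elliptic Curves*, 2nd ed., GTM 106, Springer 2009,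
  Thm. V.1.1.
* Ju. I. Manin, *On cubic congruences to a prime modulus*, Izv. Akad. Nauk SSSR 20 (1956).
* J. S. Chahal, *Algebraic Number Theory: A Brief Introduction*, CRC Press 2021, §10.3.
* J. S. Chahal, A. Soomro, J. Top, *A supplement to Manin's proof of the Hasse inequality*, Rocky
  Mountain J. Math. 44 (2014), §1.
-/

namespace Literature.NumberTheory.LFunctions

/-- **Hasse's theorem** (`rh.S36` discharged): the named fact `Literature.NumberTheory.LFunctions.hasse_bound` holds — for
every elliptic curve `W` over a finite field `F` with `q` elements,
`|#W(F) - (q + 1)| ≤ 2√q` with `#W(F) = Nat.card W.toAffine.Point`. Proof: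
`Literature.NumberTheory.EllipticCurves.HasseManin.abs_card_sub_le` (Manin's elementary argument over the function field `F(W)`,
uniform in the characteristic). [cite: SilvermanAEC2009, Thm. V.1.1] -/
theorem hasse_bound_holds : hasse_bound := fun W _ => EllipticCurves.HasseManin.abs_card_sub_le W

end Literature.NumberTheory.LFunctions
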